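import Summits.AtomisticToContinuum.Crystallization.Theorems.FrustratedLawDichotomyStrainedPatchHomForceCentred
import Summits.AtomisticToContinuum.Crystallization.Theorems.FrustratedLawDichotomyStrainedPatchHomForceCentredPath

/-!
# (C′-2) FORCE/EXEMPT PRUNE, centred form — soundness I: fold bookkeeping and the NEAR-LABEL lemma
# (27623 strained-patch piece, hcp half; decomp-a2c hand-2 g28; kernel definitions `…HomForceCentred`, calculus `…HomForceCentredPath`)

* §1 `foldAcc_ok`, ★ `foldAcc_sound` — the generic accumulation lemma: if every item `k` with `(f k).ok` admits signed coefficients `(κ, σ)` inside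
  `(f k).K / .S` with `cut k · SC ≤ val + nv + rem/2 + SC·Λ κ σ` for an ADDITIVE functional `Λ`, then so does the fold (coefficients add, `Λ` adds) —
  applied three times along the nested fold `fold3`; `sum_icc11_eq_list` (the `Finset`/`List` bridge for `[−11, 11]`);
* §2 kernel membership lemmas `mem_phi0FI` / `mem_phi1FI` / `mem_phi2FI`, `lo_pos_of_divPos`, `exists_clm_of_entries` (a linear map with prescribed
  entries — the box-centre map `U₀`);
* §3 ★★ `nearContrib_sound` — for a near label: from `v⁰ ∈ V0`, `q ∈ q`, `|v − v⁰|·SC ≤ D` componentwise and `(nearContrib …).ok`, there is a gradient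
  vector `W` with `W_a q_c ∈ K (a,c)`, `W_a ∈ S a` and `g(v)·SC ≤ val + rem/2 + SC·Σ_a W_a (v − v⁰)_a` (`g` = the closed-form slope term of
  `…HomForceKit`), by `…HomForceCentredPath.term_secondOrder` with `K = rem/SC` (the three-term `|γ″|` majorant is dominated by `remB` through the
  kernel magnitudes `|Φ′|, |Φ″|, |L|, RD, DD, DE`).
NO definitions; 0 sorry; axioms standard.  `--supports stmt-AtomisticToContinuum-27623`.
-/

namespace Summit.AtomisticToContinuum.Crystallization.Theorems.FrustratedLawDichotomyStrainedPatchHomForceCentredSound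

open scoped BigOperators RealInnerProductSpace
open Literature.Analysis.ValidatedNumerics.Numerics
open Summit.AtomisticToContinuum.Crystallization.Theorems.ChargedEnergyGapNegative (E3)
open Summit.AtomisticToContinuum.Crystallization.Theorems.FrustratedLawDichotomyStrainedPatchHomLeafCalculus (inner_eq_sum_apply)
open Summit.AtomisticToContinuum.Crystallization.Theorems.FrustratedLawDichotomyStrainedPatchHomEntryGramHcp (dot3 mem_dot3)
open Summit.AtomisticToContinuum.Crystallization.Theorems.FrustratedLawDichotomyStrainedPatchHomForceKit
open Summit.AtomisticToContinuum.Crystallization.Theorems.FrustratedLawDichotomyStrainedPatchHomForceSum (icc11)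
open Summit.AtomisticToContinuum.Crystallization.Theorems.FrustratedLawDichotomyStrainedPatchHomForceCentred
open Summit.AtomisticToContinuum.Crystallization.Theorems.FrustratedLawDichotomyStrainedPatchHomForceCentredPath (term_secondOrder)

/-! ## §1. Fold bookkeeping -/

/-- The fold guard gives every item's guard. [formal bookkeeping] -/
theorem foldAcc_ok {f : ℤ → Acc} : ∀ {l : List ℤ}, (foldAcc f l).ok = true → ∀ k ∈ l, (f k).ok = true
  | [], _ => fun k hk => by simp at hk
  | k :: ks, h => by
    simp only [foldAcc, Acc.add, Bool.and_eq_true] at h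
    intro k' hk'
    rcases List.mem_cons.1 hk' with rfl | hk'
    · exact h.1
    · exact foldAcc_ok h.2 k' hk'

/-- ★ **GENERIC ACCUMULATION.**  `Λ` additive with `Λ 0 0 = 0`; every item with its guard admits coefficients in its `K`/`S` intervals and the scaled
inequality `cut k · SC ≤ val + nv + rem/2 + SC·Λ κ σ` ⟹ the fold admits summed coefficients with the summed inequality. [folklore] -/
theorem foldAcc_sound (Λ : (Fin 3 × Fin 3 → ℝ) → (Fin 3 → ℝ) → ℝ) (hΛ0 : Λ 0 0 = 0)
    (hΛ : ∀ κ₁ σ₁ κ₂ σ₂, Λ (κ₁ + κ₂) (σ₁ + σ₂) = Λ κ₁ σ₁ + Λ κ₂ σ₂) (f : ℤ → Acc) (cut : ℤ → ℝ)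
    (hitem : ∀ k, (f k).ok = true → ∃ κ : Fin 3 × Fin 3 → ℝ, ∃ σ : Fin 3 → ℝ,
      (∀ ac, FI.mem (κ ac) ((f k).K ac)) ∧ (∀ a, FI.mem (σ a) ((f k).S a)) ∧
      cut k * SC ≤ ((f k).val : ℝ) + (f k).nv + ((f k).rem : ℝ) / 2 + SC * Λ κ σ) :
    ∀ l : List ℤ, (foldAcc f l).ok = true → ∃ κ : Fin 3 × Fin 3 → ℝ, ∃ σ : Fin 3 → ℝ,
      (∀ ac, FI.mem (κ ac) ((foldAcc f l).K ac)) ∧ (∀ a, FI.mem (σ a) ((foldAcc f l).S a)) ∧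
      (l.map cut).sum * SC ≤ ((foldAcc f l).val : ℝ) + (foldAcc f l).nv + ((foldAcc f l).rem : ℝ) / 2 + SC * Λ κ σ
  | [], _ => by
    refine ⟨0, 0, fun ac => ?_, fun a => ?_, ?_⟩
    · simpa [foldAcc, Acc.zero] using FI.mem_ofInt 0
    · simpa [foldAcc, Acc.zero] using FI.mem_ofInt 0
    · simp [foldAcc, Acc.zero, hΛ0]
  | k :: ks, hok => by
    simp only [foldAcc, Acc.add, Bool.and_eq_true] at hok
    obtain ⟨κ₁, σ₁, hK₁, hS₁, h₁⟩ := hitem k hok.1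
    obtain ⟨κ₂, σ₂, hK₂, hS₂, h₂⟩ := foldAcc_sound Λ hΛ0 hΛ f cut hitem ks hok.2
    refine ⟨κ₁ + κ₂, σ₁ + σ₂, fun ac => ?_, fun a => ?_, ?_⟩
    · simp only [foldAcc, Acc.add, Pi.add_apply]; exact FI.mem_add (hK₁ ac) (hK₂ ac)
    · simp only [foldAcc, Acc.add, Pi.add_apply]; exact FI.mem_add (hS₁ a) (hS₂ a)
    · simp only [foldAcc, Acc.add, List.map_cons, List.sum_cons, Int.cast_add, hΛ]
      rw [add_mul]
      linarith

/-- `icc11` is the literal list `icc11L`. [formal bookkeeping] -/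
theorem icc11_eq_toFinset : icc11 = icc11L.toFinset := by decide

/-- `icc11L` has no duplicates. [formal bookkeeping] -/
theorem icc11L_nodup : icc11L.Nodup := by decide

/-- ★ The `Finset`/`List` bridge: a sum over `icc11` is the list sum over `icc11L`. [formal bookkeeping] -/
theorem sum_icc11_eq_list {M : Type*} [AddCommMonoid M] (g : ℤ → M) : ∑ k ∈ icc11, g k = (icc11L.map g).sum := by
  rw [icc11_eq_toFinset, List.sum_toFinset _ icc11L_nodup]

/-! ## §2. Kernel memberships and the centre map -/

/-- `phi0FI` encloses `u⁴ − u⁷`. [folklore] -/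
theorem mem_phi0FI {x : ℝ} {u : FI} (hu : FI.mem x u) : FI.mem (x ^ 4 - x ^ 7) (phi0FI u) := by
  have h2 : FI.mem (x ^ 2) (u.mul u) := by rw [pow_two]; exact FI.mem_mul hu hu
  have h4 : FI.mem (x ^ 4) ((u.mul u).mul (u.mul u)) := by rw [show x ^ 4 = x ^ 2 * x ^ 2 by ring]; exact FI.mem_mul h2 h2
  have h7 : FI.mem (x ^ 7) ((((u.mul u).mul (u.mul u)).mul (u.mul u)).mul u) := by
    rw [show x ^ 7 = x ^ 4 * x ^ 2 * x by ring]; exact FI.mem_mul (FI.mem_mul h4 h2) hu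
  exact FI.mem_sub h4 h7

/-- `phi1FI` encloses `7u⁸ − 4u⁵`. [folklore] -/
theorem mem_phi1FI {x : ℝ} {u : FI} (hu : FI.mem x u) : FI.mem (7 * x ^ 8 - 4 * x ^ 5) (phi1FI u) := by
  have h2 : FI.mem (x ^ 2) (u.mul u) := by rw [pow_two]; exact FI.mem_mul hu hu
  have h4 : FI.mem (x ^ 4) ((u.mul u).mul (u.mul u)) := by rw [show x ^ 4 = x ^ 2 * x ^ 2 by ring]; exact FI.mem_mul h2 h2
  have h8 : FI.mem (x ^ 8 * (7 : ℤ)) ((((u.mul u).mul (u.mul u)).mul ((u.mul u).mul (u.mul u))).mulInt 7) := by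
    rw [show x ^ 8 = x ^ 4 * x ^ 4 by ring]; exact FI.mem_mulInt (FI.mem_mul h4 h4) 7
  have h5 : FI.mem (x ^ 5 * (4 : ℤ)) ((((u.mul u).mul (u.mul u)).mul u).mulInt 4) := by
    rw [show x ^ 5 = x ^ 4 * x by ring]; exact FI.mem_mulInt (FI.mem_mul h4 hu) 4
  have h := FI.mem_sub h8 h5
  have e : x ^ 8 * ((7 : ℤ) : ℝ) - x ^ 5 * ((4 : ℤ) : ℝ) = 7 * x ^ 8 - 4 * x ^ 5 := by push_cast; ring
  rw [e] at h
  exact h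

/-- `phi2FI` encloses `20u⁶ − 56u⁹`. [folklore] -/
theorem mem_phi2FI {x : ℝ} {u : FI} (hu : FI.mem x u) : FI.mem (20 * x ^ 6 - 56 * x ^ 9) (phi2FI u) := by
  have h2 : FI.mem (x ^ 2) (u.mul u) := by rw [pow_two]; exact FI.mem_mul hu hu
  have h4 : FI.mem (x ^ 4) ((u.mul u).mul (u.mul u)) := by rw [show x ^ 4 = x ^ 2 * x ^ 2 by ring]; exact FI.mem_mul h2 h2
  have h6 : FI.mem (x ^ 6 * (20 : ℤ)) ((((u.mul u).mul (u.mul u)).mul (u.mul u)).mulInt 20) := by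
    rw [show x ^ 6 = x ^ 4 * x ^ 2 by ring]; exact FI.mem_mulInt (FI.mem_mul h4 h2) 20
  have h9 : FI.mem (x ^ 9 * (56 : ℤ)) (((((u.mul u).mul (u.mul u)).mul ((u.mul u).mul (u.mul u))).mul u).mulInt 56) := by
    rw [show x ^ 9 = x ^ 4 * x ^ 4 * x by ring]; exact FI.mem_mulInt (FI.mem_mul (FI.mem_mul h4 h4) hu) 56
  have h := FI.mem_sub h6 h9
  have e : x ^ 6 * ((20 : ℤ) : ℝ) - x ^ 9 * ((56 : ℤ) : ℝ) = 20 * x ^ 6 - 56 * x ^ 9 := by push_cast; ring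
  rw [e] at h
  exact h

/-- A successful `divPos` certifies a positive lower endpoint of the divisor. [formal bookkeeping] -/
theorem lo_pos_of_divPos {I J K : FI} (h : FI.divPos I J = some K) : 0 < J.lo := by
  by_contra hlo
  simp [FI.divPos, hlo] at h

/-- ★ A continuous linear map of `E3` with prescribed entries `(U e_b)_a = m (a, b)` (used for the box-centre map `U₀`). [folklore] -/
theorem exists_clm_of_entries (m : Fin 3 × Fin 3 → ℝ) :
    ∃ U : E3 →L[ℝ] E3, ∀ ab : Fin 3 × Fin 3, (U (EuclideanSpace.single ab.2 (1 : ℝ))) ab.1 = m ab := by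
  let L : E3 →ₗ[ℝ] E3 :=
    { toFun := fun x => (EuclideanSpace.equiv (Fin 3) ℝ).symm (fun a => ∑ c : Fin 3, m (a, c) * x c)
      map_add' := fun x y => by
        ext a
        simp [Finset.sum_add_distrib, mul_add]
      map_smul' := fun r x => by
        ext a
        simp [Finset.mul_sum, mul_left_comm] }
  refine ⟨LinearMap.toContinuousLinearMap L, fun ab => ?_⟩
  obtain ⟨a, b⟩ := ab
  fin_cases a <;> fin_cases b <;> simp [L, Fin.sum_univ_three]

/-! ## §3. The near-label lemma -/

/-- Scaled componentwise bounds give scaled bounds of `|⟪r, d⟫|`, `‖d‖²` and `|⟪d, e⟫|`. [folklore] -/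
theorem inner_bounds {r d : E3} {R : Fin 3 → FI} {D : Fin 3 → ℤ} (en : Fin 3 → ℤ) {ed : ℕ} (hed : 0 < ed)
    (hr : ∀ a, FI.mem (r a) (R a)) (hD : ∀ a, |d a| * SC ≤ D a) :
    |⟪r, d⟫| * (SC : ℝ) ^ 2 ≤ ((FI.absHi (R 0) * D 0 + FI.absHi (R 1) * D 1 + FI.absHi (R 2) * D 2 : ℤ) : ℝ) ∧
    ‖d‖ ^ 2 * (SC : ℝ) ^ 2 ≤ ((D 0 * D 0 + D 1 * D 1 + D 2 * D 2 : ℤ) : ℝ) ∧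
    |⟪d, dirVec en ed⟫| * ((ed : ℝ) * SC) ≤ ((|en 0| * D 0 + |en 1| * D 1 + |en 2| * D 2 : ℤ) : ℝ) := by
  have hS := SC_pos
  have hRa : ∀ a, |r a| * SC ≤ (FI.absHi (R a) : ℝ) := fun a => FI.abs_le_absHi (hr a)
  have hDn : ∀ a, (0 : ℝ) ≤ D a := fun a => le_trans (by positivity) (hD a)
  have hprod : ∀ a, |r a * d a| * (SC : ℝ) ^ 2 ≤ (FI.absHi (R a) : ℝ) * D a := by
    intro a
    rw [abs_mul, show |r a| * |d a| * (SC : ℝ) ^ 2 = (|r a| * SC) * (|d a| * SC) by ring]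
    exact mul_le_mul (hRa a) (hD a) (by positivity) (le_trans (by positivity) (hRa a))
  have hsq : ∀ a, d a ^ 2 * (SC : ℝ) ^ 2 ≤ (D a : ℝ) * D a := by
    intro a
    have h := hD a
    have h0 : 0 ≤ |d a| * SC := by positivity
    have := mul_le_mul h h h0 (hDn a)
    rw [show |d a| * SC * (|d a| * SC) = |d a| ^ 2 * (SC : ℝ) ^ 2 by ring, sq_abs] at this
    exact this
  have hde : ∀ a, |d a * (en a : ℝ)| * SC ≤ |(en a : ℝ)| * (D a : ℝ) := by
    intro a
    rw [abs_mul, show |d a| * |(en a : ℝ)| * SC = |(en a : ℝ)| * (|d a| * SC) by ring]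
    exact mul_le_mul_of_nonneg_left (hD a) (abs_nonneg _)
  refine ⟨?_, ?_, ?_⟩
  · rw [inner_eq_sum_apply, Fin.sum_univ_three]
    push_cast
    have h := mul_le_mul_of_nonneg_right (abs_add_three (r 0 * d 0) (r 1 * d 1) (r 2 * d 2)) (le_of_lt (pow_pos hS 2))
    linarith [hprod 0, hprod 1, hprod 2, h]
  · rw [EuclideanSpace.norm_sq_eq, Fin.sum_univ_three]
    simp only [Real.norm_eq_abs, sq_abs]
    push_cast
    linarith [hsq 0, hsq 1, hsq 2]
  · have hedr : (0 : ℝ) < ed := by exact_mod_cast hed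
    rw [inner_eq_sum_apply, Fin.sum_univ_three]
    simp only [dirVec_apply]
    have e : |d 0 * ((en 0 : ℝ) / ed) + d 1 * ((en 1 : ℝ) / ed) + d 2 * ((en 2 : ℝ) / ed)| * ((ed : ℝ) * SC) =
        |d 0 * (en 0 : ℝ) + d 1 * (en 1 : ℝ) + d 2 * (en 2 : ℝ)| * SC := by
      rw [show d 0 * ((en 0 : ℝ) / ed) + d 1 * ((en 1 : ℝ) / ed) + d 2 * ((en 2 : ℝ) / ed) =
        (d 0 * (en 0 : ℝ) + d 1 * (en 1 : ℝ) + d 2 * (en 2 : ℝ)) / ed by field_simp, abs_div, abs_of_pos hedr]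
      field_simp
    rw [e]
    push_cast
    have h := mul_le_mul_of_nonneg_right (abs_add_three (d 0 * (en 0 : ℝ)) (d 1 * (en 1 : ℝ)) (d 2 * (en 2 : ℝ))) hS.le
    linarith [hde 0, hde 1, hde 2, h]

/-- The integer arithmetic of `remB`: the three-term `|γ″|` majorant is below `remB/SC` given the kernel magnitude bounds. [arithmetic] -/
theorem remB_arith {P1 P2 Lt Rd De nd2 : ℝ} {a1 a2 aL RD DD DE : ℤ} {en : Fin 3 → ℤ} {ed : ℕ} {uh Lh : FI} {Rh : Fin 3 → FI}
    {D : Fin 3 → ℤ} (hed : 0 < ed) (hP1 : 0 ≤ P1) (hP2 : 0 ≤ P2) (hLt : 0 ≤ Lt) (hDe : 0 ≤ De) (hnd : 0 ≤ nd2)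
    (bΦ1 : P1 * SC ≤ (FI.absHi (phi1FI uh) : ℝ)) (bΦ2 : P2 * SC ≤ (FI.absHi (phi2FI uh) : ℝ)) (bL : Lt * SC ≤ (FI.absHi Lh : ℝ))
    (bRD : |Rd| * (SC : ℝ) ^ 2 ≤ ((FI.absHi (Rh 0) * D 0 + FI.absHi (Rh 1) * D 1 + FI.absHi (Rh 2) * D 2 : ℤ) : ℝ))
    (bDD : nd2 * (SC : ℝ) ^ 2 ≤ ((D 0 * D 0 + D 1 * D 1 + D 2 * D 2 : ℤ) : ℝ))
    (bDE : De * ((ed : ℝ) * SC) ≤ ((|en 0| * D 0 + |en 1| * D 1 + |en 2| * D 2 : ℤ) : ℝ))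
    (ha1 : a1 = FI.absHi (phi1FI uh)) (ha2 : a2 = FI.absHi (phi2FI uh)) (haL : aL = FI.absHi Lh)
    (hRD : RD = FI.absHi (Rh 0) * D 0 + FI.absHi (Rh 1) * D 1 + FI.absHi (Rh 2) * D 2) (hDD : DD = D 0 * D 0 + D 1 * D 1 + D 2 * D 2)
    (hDE : DE = |en 0| * D 0 + |en 1| * D 1 + |en 2| * D 2) :
    4 * P2 * Rd ^ 2 * Lt + 2 * P1 * nd2 * Lt + 4 * P1 * |Rd| * De ≤ (remB en ed uh Lh Rh D : ℝ) / SC := by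
  have hS := SC_pos
  rw [← ha1] at bΦ1
  rw [← ha2] at bΦ2
  rw [← haL] at bL
  rw [← hRD] at bRD
  rw [← hDD] at bDD
  rw [← hDE] at bDE
  have hrem : remB en ed uh Lh Rh D = cdiv (4 * a2 * RD * RD * aL) SC5 + cdiv (2 * a1 * DD * aL) SC3 + cdiv (4 * a1 * RD * DE) ((ed : ℤ) * SC3) := by
    subst ha1 ha2 haL hRD hDD hDE; rfl
  have ha2n : (0 : ℝ) ≤ a2 := le_trans (by positivity) bΦ2
  have ha1n : (0 : ℝ) ≤ a1 := le_trans (by positivity) bΦ1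
  have haLn : (0 : ℝ) ≤ aL := le_trans (by positivity) bL
  have hRDn : (0 : ℝ) ≤ RD := le_trans (by positivity) bRD
  have hDDn : (0 : ℝ) ≤ DD := le_trans (by positivity) bDD
  have hDEn : (0 : ℝ) ≤ DE := le_trans (by positivity) bDE
  have hedr : (0 : ℝ) < ed := by exact_mod_cast hed
  have t1 : 4 * P2 * Rd ^ 2 * Lt * (SC : ℝ) ^ 6 ≤ 4 * (a2 : ℝ) * (RD * RD) * aL := by
    have e : 4 * P2 * Rd ^ 2 * Lt * (SC : ℝ) ^ 6 = 4 * (P2 * SC) * ((|Rd| * (SC : ℝ) ^ 2) * (|Rd| * (SC : ℝ) ^ 2)) * (Lt * SC) := by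
      rw [← sq_abs Rd]; ring
    rw [e]; gcongr
  have t2 : 2 * P1 * nd2 * Lt * (SC : ℝ) ^ 4 ≤ 2 * (a1 : ℝ) * DD * aL := by
    have e : 2 * P1 * nd2 * Lt * (SC : ℝ) ^ 4 = 2 * (P1 * SC) * (nd2 * (SC : ℝ) ^ 2) * (Lt * SC) := by ring
    rw [e]; gcongr
  have t3 : 4 * P1 * |Rd| * De * ((SC : ℝ) ^ 4 * ed) ≤ 4 * (a1 : ℝ) * RD * DE := by
    have e : 4 * P1 * |Rd| * De * ((SC : ℝ) ^ 4 * ed) = 4 * (P1 * SC) * (|Rd| * (SC : ℝ) ^ 2) * (De * ((ed : ℝ) * SC)) := by ring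
    rw [e]; gcongr
  have c1 := div_le_cdiv (a := 4 * a2 * RD * RD * aL) (b := SC5) (by norm_num [SC5])
  have c2 := div_le_cdiv (a := 2 * a1 * DD * aL) (b := SC3) (by norm_num [SC3])
  have c3 := div_le_cdiv (a := 4 * a1 * RD * DE) (b := (ed : ℤ) * SC3) (by
    have : (0 : ℤ) < SC3 := by norm_num [SC3]
    positivity)
  have hS5 : ((SC5 : ℤ) : ℝ) = (SC : ℝ) ^ 5 := by norm_num [SC5, SC]
  have hS3 : ((SC3 : ℤ) : ℝ) = (SC : ℝ) ^ 3 := by norm_num [SC3, SC]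
  rw [hS5] at c1
  rw [hS3] at c2
  push_cast at c1 c2 c3
  rw [hS3] at c3
  have u1 : 4 * P2 * Rd ^ 2 * Lt * SC ≤ (4 * (a2 : ℝ) * RD * RD * aL) / (SC : ℝ) ^ 5 := by
    rw [le_div_iff₀ (by positivity)]; nlinarith [t1]
  have u2 : 2 * P1 * nd2 * Lt * SC ≤ (2 * (a1 : ℝ) * DD * aL) / (SC : ℝ) ^ 3 := by
    rw [le_div_iff₀ (by positivity)]; nlinarith [t2]
  have u3 : 4 * P1 * |Rd| * De * SC ≤ (4 * (a1 : ℝ) * RD * DE) / ((ed : ℝ) * (SC : ℝ) ^ 3) := by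
    rw [le_div_iff₀ (by positivity)]; nlinarith [t3]
  rw [le_div_iff₀ hS, add_mul, add_mul, hrem]
  push_cast
  linarith [u1, u2, u3, c1, c2, c3]

/-- The centred per-label data when both `1/Q` enclosures exist (explicit form, kernel lets expanded). [formal bookkeeping] -/
theorem nearContrib_of_some {en : Fin 3 → ℤ} {ed : ℕ} {sn : ℤ} {sd : ℕ} {V0 q : Fin 3 → FI} {D : Fin 3 → ℤ} {u0 uh : FI}
    (h0 : FI.divPos (FI.ofInt 1) (dot3 (relFI en ed sn sd V0) (relFI en ed sn sd V0)) = some u0)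
    (hh : FI.divPos (FI.ofInt 1) (dot3 (relFI en ed sn sd (fun a => (V0 a).widen (D a))) (relFI en ed sn sd (fun a => (V0 a).widen (D a)))) =
      some uh) :
    nearContrib en ed sn sd V0 q D =
      ⟨true, ((phi0FI u0).mul (dot3 (relFI en ed sn sd V0) (dirFI en ed))).hi, 0,
        remB en ed uh (dot3 (relFI en ed sn sd (fun a => (V0 a).widen (D a))) (dirFI en ed)) (relFI en ed sn sd (fun a => (V0 a).widen (D a))) D,
        fun ac => (gradW en ed u0 (dot3 (relFI en ed sn sd V0) (dirFI en ed)) (relFI en ed sn sd V0) ac.1).mul (q ac.2),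
        gradW en ed u0 (dot3 (relFI en ed sn sd V0) (dirFI en ed)) (relFI en ed sn sd V0)⟩ := by
  unfold nearContrib
  extract_lets Vt R0 Rh L0
  rw [h0, hh]

/-- The guard of `nearContrib` certifies both `1/Q` enclosures. [formal bookkeeping] -/
theorem nearContrib_ok {en : Fin 3 → ℤ} {ed : ℕ} {sn : ℤ} {sd : ℕ} {V0 q : Fin 3 → FI} {D : Fin 3 → ℤ}
    (hok : (nearContrib en ed sn sd V0 q D).ok = true) :
    ∃ u0 uh : FI, FI.divPos (FI.ofInt 1) (dot3 (relFI en ed sn sd V0) (relFI en ed sn sd V0)) = some u0 ∧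
      FI.divPos (FI.ofInt 1) (dot3 (relFI en ed sn sd (fun a => (V0 a).widen (D a))) (relFI en ed sn sd (fun a => (V0 a).widen (D a)))) =
        some uh := by
  unfold nearContrib at hok
  extract_lets Vt R0 Rh L0 at hok
  split at hok
  · rename_i u0 uh h0 hh
    exact ⟨u0, uh, h0, hh⟩
  · exact absurd hok Bool.false_ne_true

/-- ★★ **THE NEAR-LABEL LEMMA.**  See the module docstring. [folklore] -/
theorem nearContrib_sound {en : Fin 3 → ℤ} {ed : ℕ} (hed : 0 < ed) {sn : ℤ} {sd : ℕ} (hsd : 0 < sd) {τ : ℝ} (h0 : 0 ≤ τ)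
    (hs : τ ≤ (sn : ℝ) / sd) {v v0 : E3} {V0 q : Fin 3 → FI} {D : Fin 3 → ℤ} {qr : Fin 3 → ℝ}
    (hv0 : ∀ a, FI.mem (v0 a) (V0 a)) (hq : ∀ a, FI.mem (qr a) (q a)) (hD : ∀ a, |v a - v0 a| * SC ≤ D a)
    (hok : (nearContrib en ed sn sd V0 q D).ok = true) :
    ∃ W : Fin 3 → ℝ, (∀ ac : Fin 3 × Fin 3, FI.mem (W ac.1 * qr ac.2) ((nearContrib en ed sn sd V0 q D).K ac)) ∧
      (∀ a, FI.mem (W a) ((nearContrib en ed sn sd V0 q D).S a)) ∧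
      ((‖τ • dirVec en ed - v‖ ^ 2)⁻¹ ^ 4 - (‖τ • dirVec en ed - v‖ ^ 2)⁻¹ ^ 7) *
          (τ * ⟪dirVec en ed, dirVec en ed⟫ - ⟪v, dirVec en ed⟫) * SC ≤
        ((nearContrib en ed sn sd V0 q D).val : ℝ) + ((nearContrib en ed sn sd V0 q D).rem : ℝ) / 2 +
          SC * ∑ a : Fin 3, W a * (v a - v0 a) := by
  have hS := SC_pos
  -- the two `1/Q` enclosures exist
  obtain ⟨u0, uh, hu0, huh⟩ := nearContrib_ok hok
  rw [nearContrib_of_some hu0 huh]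
  dsimp only
  -- real objects
  set e : E3 := dirVec en ed with he_def
  set r0 : E3 := τ • e - v0 with hr0
  set d : E3 := v - v0 with hd
  set x : ℝ := (‖r0‖ ^ 2)⁻¹ with hx
  -- memberships at the centre
  have hR0 : ∀ a, FI.mem (r0 a) (relFI en ed sn sd V0 a) := mem_relFI hed hsd h0 hs hv0
  have hQ0 : FI.mem (‖r0‖ ^ 2) (dot3 (relFI en ed sn sd V0) (relFI en ed sn sd V0)) := mem_sqFI hed hsd h0 hs hv0
  have hxm : FI.mem x u0 := by
    have := FI.mem_divPos hu0 (by simpa using FI.mem_ofInt 1) hQ0; simpa [hx, one_div] using this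
  have hL0 : FI.mem ⟪r0, e⟫ (dot3 (relFI en ed sn sd V0) (dirFI en ed)) := mem_dot3 hR0 (mem_dirFI en hed)
  have hΦ0 := mem_phi0FI hxm
  have hΦ1 := mem_phi1FI hxm
  refine ⟨fun a => -(2 * (7 * x ^ 8 - 4 * x ^ 5) * ⟪r0, e⟫ * r0 a + (x ^ 4 - x ^ 7) * e a), fun ac => ?_, fun a => ?_, ?_⟩
  · -- coefficient products
    have hW := FI.mem_neg (FI.mem_add (FI.mem_mul (FI.mem_mulInt (FI.mem_mul hΦ1 hL0) 2) (hR0 ac.1)) (FI.mem_mul hΦ0 (mem_dirFI en hed ac.1)))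
    have h := FI.mem_mul hW (hq ac.2)
    unfold gradW
    convert h using 2
    push_cast; ring
  · have hW := FI.mem_neg (FI.mem_add (FI.mem_mul (FI.mem_mulInt (FI.mem_mul hΦ1 hL0) 2) (hR0 a)) (FI.mem_mul hΦ0 (mem_dirFI en hed a)))
    unfold gradW
    convert hW using 2
    push_cast; ring
  · -- the second-order bound along the segment `v0 + t d`
    have hval : (x ^ 4 - x ^ 7) * ⟪r0, e⟫ * SC ≤ (((phi0FI u0).mul (dot3 (relFI en ed sn sd V0) (dirFI en ed))).hi : ℝ) :=
      (FI.mem_def.1 (FI.mem_mul hΦ0 hL0)).2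
    -- points of the segment lie in the widened box
    have hseg : ∀ t ∈ Set.Icc (0 : ℝ) 1, ∀ a, FI.mem ((v0 + t • d) a) ((V0 a).widen (D a)) := by
      intro t ht a
      refine FI.mem_widen (hv0 a) ?_
      rw [PiLp.add_apply, PiLp.smul_apply, smul_eq_mul, add_sub_cancel_left, abs_mul, abs_of_nonneg ht.1]
      calc t * |d a| * SC ≤ 1 * |d a| * SC := by gcongr; exact ht.2
        _ = |v a - v0 a| * SC := by rw [one_mul, hd, PiLp.sub_apply]
        _ ≤ D a := hD a
    have hpos_lo := lo_pos_of_divPos huh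
    set Rh : Fin 3 → FI := relFI en ed sn sd (fun a => (V0 a).widen (D a)) with hRh
    have hrt : ∀ t : ℝ, τ • e - (v0 + t • d) = r0 - t • d := fun t => by
      rw [hr0, sub_add_eq_sub_sub]
    have hDreal : ∀ a, |d a| * SC ≤ D a := fun a => by rw [hd, PiLp.sub_apply]; exact hD a
    have hRt : ∀ t ∈ Set.Icc (0 : ℝ) 1, ∀ a, FI.mem ((r0 - t • d) a) (Rh a) := by
      intro t ht a; rw [← hrt]; exact mem_relFI hed hsd h0 hs (hseg t ht) a
    have hQt : ∀ t ∈ Set.Icc (0 : ℝ) 1, FI.mem (‖r0 - t • d‖ ^ 2) (dot3 Rh Rh) := by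
      intro t ht; rw [← hrt]; exact mem_sqFI hed hsd h0 hs (hseg t ht)
    have hpos : ∀ t ∈ Set.Icc (0 : ℝ) 1, r0 - t • d ≠ 0 := by
      intro t ht h
      have := FI.pos_of_lo_pos (hQt t ht) hpos_lo
      rw [h, norm_zero] at this
      norm_num at this
    have hK : ∀ t ∈ Set.Icc (0 : ℝ) 1,
        4 * |20 * (‖r0 - t • d‖ ^ 2)⁻¹ ^ 6 - 56 * (‖r0 - t • d‖ ^ 2)⁻¹ ^ 9| * ⟪r0 - t • d, d⟫ ^ 2 * |⟪r0 - t • d, e⟫| +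
        2 * |7 * (‖r0 - t • d‖ ^ 2)⁻¹ ^ 8 - 4 * (‖r0 - t • d‖ ^ 2)⁻¹ ^ 5| * ‖d‖ ^ 2 * |⟪r0 - t • d, e⟫| +
        4 * |7 * (‖r0 - t • d‖ ^ 2)⁻¹ ^ 8 - 4 * (‖r0 - t • d‖ ^ 2)⁻¹ ^ 5| * |⟪r0 - t • d, d⟫| * |⟪d, e⟫| ≤
          (remB en ed uh (dot3 Rh (dirFI en ed)) Rh D : ℝ) / SC := by
      intro t ht
      have hxt : FI.mem ((‖r0 - t • d‖ ^ 2)⁻¹) uh := by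
        have := FI.mem_divPos huh (by simpa using FI.mem_ofInt 1) (hQt t ht); simpa [one_div] using this
      have bΦ1 := FI.abs_le_absHi (mem_phi1FI hxt)
      have bΦ2 := FI.abs_le_absHi (mem_phi2FI hxt)
      have bL := FI.abs_le_absHi (mem_dot3 (hRt t ht) (mem_dirFI en hed))
      obtain ⟨bRD, bDD, bDE⟩ := inner_bounds en hed (hRt t ht) hDreal
      exact remB_arith hed (abs_nonneg _) (abs_nonneg _) (abs_nonneg _) (abs_nonneg _) (by positivity) bΦ1 bΦ2 bL bRD bDD bDE
        rfl rfl rfl rfl rfl rfl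
    have hmain := term_secondOrder r0 d e hpos hK
    have hrd : r0 - d = τ • e - v := by rw [hr0, hd]; abel
    have hinner : ⟪τ • e - v, e⟫ = τ * ⟪e, e⟫ - ⟪v, e⟫ := by rw [inner_sub_left, real_inner_smul_left]
    rw [hrd, hinner] at hmain
    have hsum : ∑ a : Fin 3, -(2 * (7 * x ^ 8 - 4 * x ^ 5) * ⟪r0, e⟫ * r0 a + (x ^ 4 - x ^ 7) * e a) * d a =
        ∑ a : Fin 3, (fun a => -(2 * (7 * x ^ 8 - 4 * x ^ 5) * ⟪r0, e⟫ * r0 a + (x ^ 4 - x ^ 7) * e a)) a * (v a - v0 a) := by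
      refine Finset.sum_congr rfl fun a _ => ?_
      show _ = -(2 * (7 * x ^ 8 - 4 * x ^ 5) * ⟪r0, e⟫ * r0 a + (x ^ 4 - x ^ 7) * e a) * (v a - v0 a)
      rw [hd]
      rfl
    rw [hsum] at hmain
    have key := mul_le_mul_of_nonneg_right hmain hS.le
    have hrem : (remB en ed uh (dot3 Rh (dirFI en ed)) Rh D : ℝ) / SC / 2 * SC = (remB en ed uh (dot3 Rh (dirFI en ed)) Rh D : ℝ) / 2 := by
      field_simp
    rw [add_mul, add_mul, hrem] at key
    linarith [hval, key]

end Summit.AtomisticToContinuum.Crystallization.Theorems.FrustratedLawDichotomyStrainedPatchHomForceCentredSound
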